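import Literature.Computability.AlgebraicComplexity.GroupTheoreticMatMul

/-!
# ω-census tool law: the ROTATION OBSTRUCTION for simultaneous-TPP families

HONEST FRAMING (pub-omega census; verbatim): lottery ticket; floor = certified bounds/negative ranges.
Census STRUCTURE bookkeeping (a structural NEGATIVE used by the track's twisted-orbit engines `orbtw.c` / `orbtw2.c`, seat pub-omega-stpp-3 gen 19,
2026-08-27), nothing about `ω`.

The STPP property (CKSU 2005 Def. 5.1, tree form `IsSTPP`) of a family `(A i, B i, C i)` is invariant under permuting the three ROLES of every triple
simultaneously (`exists_isSTPP_rotate` / `exists_isSTPP_reverse`), which is what makes the orbit of one triple under `g = (M, σ) ∈ Aut(H) × S₃` a legitimate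
structured candidate.  But a family can never contain a triple TOGETHER WITH its role-rotations at other indices: if some element lies in `A i ∩ C j`, some in
`B i ∩ C k` and some in `A k ∩ B j` with `(i, j, k)` not all equal, the one-clause form has the non-trivial solution `(a − c) + (c − b) + (b − a) = 0`
(`not_isSTPP_of_shared_elements`); in particular `(A, B, C)` at index `i`, `(B, C, A)` at index `j ≠ i` and `(C, A, B)` at index `k` with non-empty `A, B, C`
kill the family (`not_isSTPP_of_rotations`).  This is why every twisted type whose group `⟨(M, σ)⟩` contains a pure role 3-cycle `(1, σ)` — e.g. `(−1, 3-cycle)` with a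
base triple, or `({±1}, 3-cycle)` with symmetric triples — is reported 'structurally NONE' by the engines, in every group.

References: H. Cohn, R. Kleinberg, B. Szegedy, C. Umans, FOCS 2005 (arXiv:math/0511460), Def. 5.1.  Seat pub-omega-stpp-3 (gen 19), 2026-08-27.
-/

namespace Summit.MatrixMultiplication.OmegaCensus

open Literature.Computability.AlgebraicComplexity

/-- **Shared-element obstruction.**  If `a ∈ A i ∩ C j`, `b ∈ B i ∩ C k`, `c ∈ A k ∩ B j` and `(i, j, k)` are not all equal, the family is not STPP:
the instance `s' = a, s = c, t = b, t' = c, u = a, u' = b` of the one-clause form gives `(a − c) + (c − b) + (b − a) = 0` with indices not all equal.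
[cite: CohnKleinbergSzegedyUmans2005, Def. 5.1] -/
theorem not_isSTPP_of_shared_elements {H : Type*} [AddCommGroup H] {N : ℕ} {A B C : Fin N → Finset H}
    {i j k : Fin N} (hne : ¬(i = j ∧ j = k)) {a b c : H}
    (haA : a ∈ A i) (haC : a ∈ C j) (hbB : b ∈ B i) (hbC : b ∈ C k) (hcA : c ∈ A k) (hcB : c ∈ B j) :
    ¬ IsSTPP A B C := by
  intro h
  have h0 : (a - c) + (c - b) + (b - a) = (0 : H) := by abel
  obtain ⟨hij, hjk, -, -, -⟩ := h i j k c hcA a haA b hbB c hcB a haC b hbC h0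
  exact hne ⟨hij, hjk⟩

/-- **Rotation obstruction.**  If a family carries `(A i, B i, C i) = (X, Y, Z)`, `(A j, B j, C j) = (Y, Z, X)` and `(A k, B k, C k) = (Z, X, Y)` — a triple and
its two role-rotations — at indices `(i, j, k)` not all equal, with `X, Y, Z` non-empty, then it is not STPP; only the six memberships
`A i = X, B i = Y, B j = Z, C j = X, A k = Z, C k = Y` are used (the sets `C i`, `A j`, `B k` are irrelevant).
[cite: CohnKleinbergSzegedyUmans2005, Def. 5.1] -/
theorem not_isSTPP_of_rotations {H : Type*} [AddCommGroup H] {N : ℕ} {A B C : Fin N → Finset H}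
    {i j k : Fin N} (hne : ¬(i = j ∧ j = k)) {X Y Z : Finset H} (hX : X.Nonempty) (hY : Y.Nonempty) (hZ : Z.Nonempty)
    (hAi : A i = X) (hBi : B i = Y) (hBj : B j = Z) (hCj : C j = X) (hAk : A k = Z) (hCk : C k = Y) :
    ¬ IsSTPP A B C := by
  obtain ⟨a, ha⟩ := hX
  obtain ⟨b, hb⟩ := hY
  obtain ⟨c, hc⟩ := hZ
  exact not_isSTPP_of_shared_elements hne (hAi ▸ ha) (hCj ▸ ha) (hBi ▸ hb) (hCk ▸ hb) (hAk ▸ hc) (hBj ▸ hc)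

/-!
## Appendix (seat pub-omega-stpp-3 gen 20, 2026-08-27): the EQUAL-SUMS form and the CUBE-ROOT TWIST OBSTRUCTION

HONEST FRAMING (verbatim): lottery ticket; floor = certified bounds/negative ranges.  Structural bookkeeping for the twisted-orbit engines, nothing about `ω`.

`not_isSTPP_of_equal_sums` is the general shape of every 'structural NONE' the engines report: one transversal `x ∈ A i`, `x₁ ∈ B j`, `x₂ ∈ C k` and one
transversal `y ∈ B i`, `y₁ ∈ C j`, `y₂ ∈ A k` with the same sum, at indices `(i, j, k)` not all equal, is a non-trivial solution of the one-clause form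
(`not_isSTPP_of_shared_elements` above is the case `(x, x₁, x₂) = (a, c, b)`, `(y, y₁, y₂) = (b, a, c)`).  The CUBE-ROOT TWIST obstruction is the case that
killed the last structured menu item at the `k = 6` gate ℤ/127 (desk 2026-08-27, engine `orbtw2.c`: «NONE structural: 24 instance(s) vanish identically» for
type `GG` under `g = (×19, 3-cycle)`): if a family carries a triple `(X, Y, Z)` at index `i` together with its twist `g·T = (φZ, φX, φY)` at index `j` and
`g²·T = (φ²Y, φ²Z, φ²X)` at index `k` (`(g·T)_{σ r} = φ(T_r)`, `σ` the 3-cycle of roles `A → B → C → A`) for an additive endomorphism `φ` with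
`x + φ x + φ² x = 0` on an element of `X` and on an element of `Y`, then the instance `s' = x, t' = φ x, u' = φ² x, t = y, u = φ y, s = φ² y` has word
`(x + φx + φ²x) − (y + φy + φ²y) = 0`.  In a cyclic group of prime order `p` every automorphism `M` of order 3 is multiplication by a primitive cube root
of unity `u`, and `1 + u + u² = 0`; so EVERY twisted family type whose group `⟨(M, σ)⟩` contains an element `(M', 3-cycle)` with `M'` of order 3 — in
particular all `σ = cyc / cyc2` types with `|M| ∈ {3, 6}` and the two-orbit type `GG` under `(C₃, cyc)` — is dead in `ℤ/p` (`p ≡ 1 (mod 3)`), which with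
`not_isSTPP_of_rotations` (`M' = 1`) leaves only `σ ∈ {id, (B C)}` types there.  The ring form `not_isSTPP_of_cubeRootTwist_mul` records exactly this.
Only six memberships are used in each statement; the other three sets of each triple are irrelevant.
-/

/-- **Equal-sums obstruction** (the general shape of a 'structural NONE').  If `x ∈ A i`, `x₁ ∈ B j`, `x₂ ∈ C k` and `y ∈ B i`, `y₁ ∈ C j`, `y₂ ∈ A k`
with `x + x₁ + x₂ = y + y₁ + y₂` and `(i, j, k)` not all equal, the family is not STPP: the instance `s' = x, s = y₂, t' = x₁, t = y, u' = x₂, u = y₁`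
of the one-clause form has word `(x − y₂) + (x₁ − y) + (x₂ − y₁) = 0`. [cite: CohnKleinbergSzegedyUmans2005, Def. 5.1] -/
theorem not_isSTPP_of_equal_sums {H : Type*} [AddCommGroup H] {N : ℕ} {A B C : Fin N → Finset H}
    {i j k : Fin N} (hne : ¬(i = j ∧ j = k)) {x x₁ x₂ y y₁ y₂ : H}
    (hx : x ∈ A i) (hx₁ : x₁ ∈ B j) (hx₂ : x₂ ∈ C k) (hy : y ∈ B i) (hy₁ : y₁ ∈ C j) (hy₂ : y₂ ∈ A k)
    (hsum : x + x₁ + x₂ = y + y₁ + y₂) :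
    ¬ IsSTPP A B C := by
  intro h
  have h0 : (x - y₂) + (x₁ - y) + (x₂ - y₁) = (0 : H) := by
    have : (x - y₂) + (x₁ - y) + (x₂ - y₁) = (x + x₁ + x₂) - (y + y₁ + y₂) := by abel
    rw [this, hsum, sub_self]
  obtain ⟨hij, hjk, -, -, -⟩ := h i j k y₂ hy₂ x hx y hy x₁ hx₁ y₁ hy₁ x₂ hx₂ h0
  exact hne ⟨hij, hjk⟩

/-- **Cube-root twist obstruction** (endomorphism form).  Let `φ : H →+ H` and let `x ∈ A i`, `y ∈ B i` satisfy `x + φ x + φ (φ x) = 0` and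
`y + φ y + φ (φ y) = 0`.  If the family also carries `φ x ∈ B j`, `φ y ∈ C j` (the twist `g·T` of the triple at `i` by `g = (φ, 3-cycle)`) and
`φ (φ y) ∈ A k`, `φ (φ x) ∈ C k` (the twist `g²·T`) at indices `(i, j, k)` not all equal, it is not STPP.
[cite: CohnKleinbergSzegedyUmans2005, Def. 5.1] -/
theorem not_isSTPP_of_cubeRootTwist {H : Type*} [AddCommGroup H] {N : ℕ} {A B C : Fin N → Finset H}
    {i j k : Fin N} (hne : ¬(i = j ∧ j = k)) (φ : H →+ H) {x y : H}
    (hx0 : x + φ x + φ (φ x) = 0) (hy0 : y + φ y + φ (φ y) = 0)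
    (hx : x ∈ A i) (hy : y ∈ B i) (hx₁ : φ x ∈ B j) (hy₁ : φ y ∈ C j) (hy₂ : φ (φ y) ∈ A k) (hx₂ : φ (φ x) ∈ C k) :
    ¬ IsSTPP A B C :=
  not_isSTPP_of_equal_sums hne hx hx₁ hx₂ hy hy₁ hy₂ (by rw [hx0, hy0])

/-- **Cube-root twist obstruction** (ring form, the case of a cyclic group of prime order `p ≡ 1 (mod 3)` with `M = ×u`).  In a commutative ring `R` with an
element `u` satisfying `1 + u + u * u = 0`, no STPP family of subsets of `R` carries a triple with `x ∈ A i`, `y ∈ B i` together with `u * x ∈ B j`,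
`u * y ∈ C j` and `u * (u * y) ∈ A k`, `u * (u * x) ∈ C k` at indices not all equal — e.g. a triple with its twists by `(×u, 3-cycle)` and `(×u², 3-cycle²)`.
[cite: CohnKleinbergSzegedyUmans2005, Def. 5.1] -/
theorem not_isSTPP_of_cubeRootTwist_mul {R : Type*} [CommRing R] {N : ℕ} {A B C : Fin N → Finset R}
    {i j k : Fin N} (hne : ¬(i = j ∧ j = k)) {u : R} (hu : 1 + u + u * u = 0) {x y : R}
    (hx : x ∈ A i) (hy : y ∈ B i) (hx₁ : u * x ∈ B j) (hy₁ : u * y ∈ C j) (hy₂ : u * (u * y) ∈ A k) (hx₂ : u * (u * x) ∈ C k) :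
    ¬ IsSTPP A B C := by
  have key : ∀ z : R, z + u * z + u * (u * z) = 0 := fun z => by
    have : z + u * z + u * (u * z) = (1 + u + u * u) * z := by ring
    rw [this, hu, zero_mul]
  exact not_isSTPP_of_cubeRootTwist hne (AddMonoidHom.mulLeft u) (key x) (key y) hx hy hx₁ hy₁ hy₂ hx₂

/-- The concrete instance at the `k = 6` gate: in `ZMod 127`, `u = 19` is a primitive cube root of unity (`1 + 19 + 19² = 381 = 3 · 127`), so no STPP family in
`ℤ/127` contains a triple together with its twists by `(×19, 3-cycle)` and `(×107, 3-cycle²)` at indices not all equal (the desk verdict «NONE structural» of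
`orbtw2.c` for type `GG` under `(×19, cyc)`, 2026-08-27). [cite: CohnKleinbergSzegedyUmans2005, Def. 5.1] -/
theorem not_isSTPP_of_cubeRootTwist_zmod127 {N : ℕ} {A B C : Fin N → Finset (ZMod 127)}
    {i j k : Fin N} (hne : ¬(i = j ∧ j = k)) {x y : ZMod 127}
    (hx : x ∈ A i) (hy : y ∈ B i) (hx₁ : 19 * x ∈ B j) (hy₁ : 19 * y ∈ C j) (hy₂ : 19 * (19 * y) ∈ A k) (hx₂ : 19 * (19 * x) ∈ C k) :
    ¬ IsSTPP A B C :=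
  not_isSTPP_of_cubeRootTwist_mul hne (u := (19 : ZMod 127)) (by decide) hx hy hx₁ hy₁ hy₂ hx₂

end Summit.MatrixMultiplication.OmegaCensus
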